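import Mathlib.RingTheory.Valuation.ValuationSubring
import Mathlib.RingTheory.LocalRing.ResidueField.Basic
import Mathlib.FieldTheory.IsAlgClosed.Basic
import Mathlib.Algebra.Polynomial.Taylor
import Mathlib.Algebra.Polynomial.Roots
import HarnessLib

/-!
# Reduction of split polynomials modulo a valuation ring: integral roots, primitive models,
  Gauss values and the dominant index

Topic `RingTheory/Valuation`.  Let `A` be a valuation subring of a field `K` (Mathlib
`ValuationSubring K`; valuation `v = A.valuation`, residue field `κ = IsLocalRing.ResidueField A`,
reduction map `IsLocalRing.residue A`).  For a polynomial `f ∈ K[X]` that splits over `K` (always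
the case when `K` is algebraically closed) this file packages the elementary "Newton polygon at one
vertex" dictionary between the ROOTS of `f` and the REDUCTION of `f`:

* `intRoots A f` — the multiset of roots of `f` lying in `A` (with multiplicity), `redRoots A f` —
  their residues, `redPoly A f = ∏ (X - ᾱ)` over them (monic);
* `exists_model` — a **primitive model**: a constant `c ≠ 0` and `g ∈ A[X]` with `g = c • f` whose
  reduction is exactly `redPoly A f` (`c f = ∏_{α ∈ A} (X - α) · ∏_{α ∉ A} (1 - α⁻¹ X)`): roots
  outside `A` disappear, roots inside `A` reduce;
* `gaussVal A f = max_i v(f_i)` — the Gauss value, `v c · gaussVal f = 1` for a model;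
* the **dominant index**: `n = #intRoots A f` (the number of roots of valuation `≤ 1`) is an index
  at which `v(f_n)` attains the Gauss value, and `v(f_i) < gaussVal f` for every `i > n`
  (`valuation_coeff_card_intRoots`, `valuation_coeff_lt_gaussVal`); more generally, after a Taylor
  expansion at `a ∈ A`, the first coefficient of full valuation sits in degree
  `k = ord_{ā} (redPoly A f)` (`residue_taylor_coeff_eq_zero`, `isUnit_taylor_coeff`);
* residue classes: `(redRoots A f).count ā` is the number of roots of `f` in the residue class of
  `ā` and equals `rootMultiplicity ā (redPoly A f)`.

All of this is standard non-archimedean folklore (e.g. the Newton polygon of a split polynomial,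
Neukirch II §6; Bosch–Güntzer–Remmert 5.1); Mathlib has real-valued Gauss norms
(`Polynomial.gaussNorm`) but not this root-level dictionary for an abstract valuation ring, which is
what reduction arguments over a place of `ℂ` above a prime need (consumer:
`Literature.NumberTheory.DiophantineGeometry`, reduction of Belyi maps).

## Design

Value-group valued (`A.ValueGroup`), no real numbers, no topology; theorems only need `f.Splits`
(supplied by `IsAlgClosed.splits`).  `noncomputable section`.
-/

noncomputable section

open Polynomial IsLocalRing
open scoped Classical

namespace Literature.RingTheory.Valuation

variable {K : Type*} [Field K] (A : ValuationSubring K)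

/-! ## Integral roots and the reduced polynomial -/

/-- The roots of `f` (with multiplicity) that lie in the valuation ring `A`, as a multiset of `A`.
[folklore] -/
def intRoots (f : K[X]) : Multiset A :=
  f.roots.filterMap fun x => if h : x ∈ A then some ⟨x, h⟩ else none

/-- The residues of the integral roots of `f`. [folklore] -/
def redRoots (f : K[X]) : Multiset (ResidueField A) :=
  (intRoots A f).map (residue A)

/-- The reduction of (a primitive model of) a split polynomial `f`: the monic polynomial over the
residue field whose roots are the residues of the integral roots of `f`. [folklore] -/
def redPoly (f : K[X]) : (ResidueField A)[X] :=
  ((redRoots A f).map fun a => X - C a).prod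

/-- The zero polynomial has no integral roots (Mathlib convention `roots 0 = 0`). [folklore] -/
theorem intRoots_zero : intRoots A (0 : K[X]) = 0 := by
  simp [intRoots]

/-- Forgetting that the integral roots are integral gives back the roots of `f` in `A`.
[folklore] -/
theorem map_val_intRoots (f : K[X]) :
    (intRoots A f).map Subtype.val = f.roots.filter (· ∈ A) := by
  unfold intRoots
  induction f.roots using Multiset.induction_on with
  | empty => simp
  | cons x M ih =>
    rw [Multiset.filterMap_cons, Multiset.filter_cons]
    by_cases hx : x ∈ A
    · simp [hx, ih]
    · simp [hx, ih]

/-- Membership in `intRoots`. [folklore] -/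
theorem mem_intRoots {f : K[X]} {a : A} : a ∈ intRoots A f ↔ (a : K) ∈ f.roots := by
  rw [← Multiset.mem_map_of_injective Subtype.val_injective, map_val_intRoots, Multiset.mem_filter]
  exact and_iff_left a.2

/-- Counting in `intRoots`. [folklore] -/
theorem count_intRoots [DecidableEq K] (f : K[X]) (a : A) :
    (intRoots A f).count a = f.roots.count (a : K) := by
  classical
  have h : ((intRoots A f).map Subtype.val).count (a : K) = (f.roots.filter (· ∈ A)).count (a : K) := by
    rw [map_val_intRoots]
  rw [Multiset.count_map_eq_count' _ _ Subtype.val_injective] at h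
  rw [h, Multiset.count_filter_of_pos (SetLike.coe_mem a)]

/-- The number of integral roots is the number of roots of valuation `≤ 1`. [folklore] -/
theorem card_intRoots (f : K[X]) :
    Multiset.card (intRoots A f) = Multiset.card (f.roots.filter (· ∈ A)) := by
  rw [← map_val_intRoots, Multiset.card_map]

/-- `redPoly` is monic. [folklore] -/
theorem monic_redPoly (f : K[X]) : (redPoly A f).Monic :=
  monic_multisetProd_X_sub_C _

/-- `redPoly` is non-zero. [folklore] -/
theorem redPoly_ne_zero [Nontrivial (ResidueField A)] (f : K[X]) : redPoly A f ≠ 0 :=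
  (monic_redPoly A f).ne_zero

/-- The roots of `redPoly A f` are the residues of the integral roots. [folklore] -/
theorem roots_redPoly (f : K[X]) : (redPoly A f).roots = redRoots A f :=
  roots_multiset_prod_X_sub_C _

/-- The degree of `redPoly A f` is the number of integral roots of `f`. [folklore] -/
theorem natDegree_redPoly (f : K[X]) :
    (redPoly A f).natDegree = Multiset.card (intRoots A f) := by
  rw [redPoly, natDegree_multiset_prod_X_sub_C_eq_card, redRoots, Multiset.card_map]

/-- The multiplicity of `ā` as a root of `redPoly A f` is the number of integral roots of `f`
(with multiplicity) reducing to `ā`. [folklore] -/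
theorem rootMultiplicity_redPoly [DecidableEq (ResidueField A)] (f : K[X]) (a : ResidueField A) :
    (redPoly A f).rootMultiplicity a = (redRoots A f).count a := by
  rw [← count_roots, roots_redPoly]

/-- The number of integral roots of `f` reducing to `ā`, as a filter-count. [folklore] -/
theorem count_redRoots [DecidableEq (ResidueField A)] (f : K[X]) (a : ResidueField A) :
    (redRoots A f).count a =
      Multiset.card ((intRoots A f).filter fun b => residue A b = a) := by
  rw [redRoots, Multiset.count_map]
  congr 1
  exact Multiset.filter_congr fun b _ => eq_comm

/-- `redPoly` of the zero polynomial is `1` (no roots). [folklore] -/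
theorem redPoly_zero : redPoly A (0 : K[X]) = 1 := by
  simp [redPoly, redRoots, intRoots_zero]

/-! ## Primitive models -/

section Model

/-- `∏_{a ∈ M} (X - a)` maps under a ring homomorphism to `∏ (X - f a)`. [folklore] -/
theorem map_prod_X_sub_C {R S : Type*} [CommRing R] [CommRing S] (M : Multiset R) (f : R →+* S) :
    ((M.map fun a => X - C a).prod).map f = ((M.map f).map fun a => X - C a).prod := by
  rw [Polynomial.map_multiset_prod, Multiset.map_map, Multiset.map_map]
  congr 1
  exact Multiset.map_congr rfl fun a _ => by simp

/-- `∏_{b ∈ M} (1 - b X)` maps under a ring homomorphism to `∏ (1 - f b · X)`. [folklore] -/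
theorem map_prod_one_sub_C_mul_X {R S : Type*} [CommRing R] [CommRing S] (M : Multiset R)
    (f : R →+* S) :
    ((M.map fun b => (1 : R[X]) - C b * X).prod).map f =
      ((M.map f).map fun b => (1 : S[X]) - C b * X).prod := by
  rw [Polynomial.map_multiset_prod, Multiset.map_map, Multiset.map_map]
  congr 1
  exact Multiset.map_congr rfl fun a _ => by simp

/-- An element of `K` outside `A` is non-zero and its inverse lies in the maximal ideal of `A`.
[folklore] -/
theorem inv_mem_of_not_mem {x : K} (hx : x ∉ A) : x⁻¹ ∈ A ∧ x ≠ 0 ∧ A.valuation x⁻¹ < 1 := by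
  have hx0 : x ≠ 0 := fun h => hx (h ▸ A.zero_mem)
  have hinv : x⁻¹ ∈ A := (A.mem_or_inv_mem x).resolve_left hx
  refine ⟨hinv, hx0, ?_⟩
  have hgt : 1 < A.valuation x := by
    rw [← not_le, A.valuation_le_one_iff]; exact hx
  rw [map_inv₀]
  exact inv_lt_one_of_one_lt₀ hgt

/-- The inverses of the non-integral roots of `f`, as a multiset of `A` (they lie in the maximal
ideal). [folklore] -/
def outInvRoots (f : K[X]) : Multiset A :=
  f.roots.filterMap fun x => if h : x ∈ A then none else some ⟨x⁻¹, (inv_mem_of_not_mem A h).1⟩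

/-- Forgetting integrality: `outInvRoots` are the inverses of the roots outside `A`. [folklore] -/
theorem map_val_outInvRoots (f : K[X]) :
    (outInvRoots A f).map Subtype.val = (f.roots.filter (· ∉ A)).map (·⁻¹) := by
  unfold outInvRoots
  induction f.roots using Multiset.induction_on with
  | empty => simp
  | cons x M ih =>
    rw [Multiset.filterMap_cons, Multiset.filter_cons]
    by_cases hx : x ∈ A
    · simp [hx, ih]
    · simp [hx, ih]

/-- Every element of `outInvRoots` has valuation `< 1`. [folklore] -/
theorem valuation_lt_one_of_mem_outInvRoots {f : K[X]} {b : A} (hb : b ∈ outInvRoots A f) :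
    A.valuation (b : K) < 1 := by
  have h : (b : K) ∈ (outInvRoots A f).map Subtype.val := Multiset.mem_map_of_mem _ hb
  rw [map_val_outInvRoots, Multiset.mem_map] at h
  obtain ⟨x, hx, hxb⟩ := h
  rw [Multiset.mem_filter] at hx
  rw [← hxb]
  exact (inv_mem_of_not_mem A hx.2).2.2

/-- The residue of every element of `outInvRoots` vanishes. [folklore] -/
theorem residue_eq_zero_of_mem_outInvRoots {f : K[X]} {b : A} (hb : b ∈ outInvRoots A f) :
    residue A b = 0 := by
  rw [residue_eq_zero_iff, A.valuation_lt_one_iff]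
  exact valuation_lt_one_of_mem_outInvRoots A hb

/-- **Primitive model of a split polynomial.**  If `f ≠ 0` splits over `K`, there are `c ≠ 0` in
`K` and `g ∈ A[X]` with `g = c · f` (as polynomials over `K`) whose reduction is `redPoly A f`:
explicitly `c · f = ∏_{α ∈ A} (X - α) · ∏_{α ∉ A} (1 - α⁻¹ X)` over the roots `α` of `f`.
[folklore] -/
theorem exists_model {f : K[X]} (hf : f ≠ 0) (hs : f.Splits) :
    ∃ c : K, c ≠ 0 ∧ ∃ g : A[X], g.map (algebraMap A K) = C c * f ∧
      g.map (residue A) = redPoly A f := by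
  classical
  set Min := intRoots A f with hMin
  set Mout := outInvRoots A f with hMout
  set g : A[X] := (Min.map fun a => X - C a).prod * (Mout.map fun b => (1 : A[X]) - C b * X).prod
    with hg
  set cout : K := ((f.roots.filter (· ∉ A)).map fun x => -x⁻¹).prod with hcout
  have hlc : f.leadingCoeff ≠ 0 := leadingCoeff_ne_zero.mpr hf
  have hcout0 : cout ≠ 0 := by
    intro h0
    rw [hcout, Multiset.prod_eq_zero_iff, Multiset.mem_map] at h0
    obtain ⟨x, hx, hx0⟩ := h0
    rw [Multiset.mem_filter] at hx
    exact (inv_mem_of_not_mem A hx.2).2.1 (inv_eq_zero.mp (neg_eq_zero.mp hx0))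
  refine ⟨f.leadingCoeff⁻¹ * cout, mul_ne_zero (inv_ne_zero hlc) hcout0, g, ?_, ?_⟩
  · -- `g = c f`
    have hφ : (⇑(algebraMap A K) : A → K) = Subtype.val := rfl
    have hin : ((Min.map fun a => X - C a).prod).map (algebraMap A K) =
        ((f.roots.filter (· ∈ A)).map fun x => X - C x).prod := by
      rw [map_prod_X_sub_C, hφ, hMin, map_val_intRoots]
    have hout : ((Mout.map fun b => (1 : A[X]) - C b * X).prod).map (algebraMap A K) =
        C cout * ((f.roots.filter (· ∉ A)).map fun x => X - C x).prod := by
      rw [map_prod_one_sub_C_mul_X, hφ, hMout, map_val_outInvRoots, Multiset.map_map, hcout,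
        map_multiset_prod C, Multiset.map_map, ← Multiset.prod_map_mul]
      congr 1
      refine Multiset.map_congr rfl fun x hx => ?_
      rw [Multiset.mem_filter] at hx
      have hx0 : x ≠ 0 := (inv_mem_of_not_mem A hx.2).2.1
      simp only [Function.comp_apply, map_neg]
      rw [neg_mul, mul_sub, ← C_mul, inv_mul_cancel₀ hx0, C_1]
      ring
    rw [hg, Polynomial.map_mul, hin, hout]
    set Pin := ((f.roots.filter (· ∈ A)).map fun x => X - C x).prod with hPin
    set Pout := ((f.roots.filter (· ∉ A)).map fun x => X - C x).prod with hPout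
    have hsplit : (f.roots.map fun x => X - C x).prod = Pin * Pout := by
      conv_lhs => rw [← Multiset.filter_add_not (· ∈ A) f.roots]
      rw [Multiset.map_add, Multiset.prod_add]
    have hfe : f = C f.leadingCoeff * (Pin * Pout) := by
      rw [← hsplit]; exact hs.eq_prod_roots
    have hCC : C f.leadingCoeff⁻¹ * C f.leadingCoeff = (1 : K[X]) := by
      rw [← C_mul, inv_mul_cancel₀ hlc, C_1]
    calc Pin * (C cout * Pout)
        = C f.leadingCoeff⁻¹ * C f.leadingCoeff * C cout * (Pin * Pout) := by rw [hCC]; ring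
      _ = C (f.leadingCoeff⁻¹ * cout) * (C f.leadingCoeff * (Pin * Pout)) := by
          rw [C_mul]; ring
      _ = C (f.leadingCoeff⁻¹ * cout) * f := by rw [← hfe]
  · -- reduction
    rw [hg, Polynomial.map_mul, map_prod_X_sub_C, map_prod_one_sub_C_mul_X]
    have h1 : ((Mout.map (residue A)).map fun b => (1 : (ResidueField A)[X]) - C b * X).prod = 1 := by
      refine Multiset.prod_eq_one fun P hP => ?_
      rw [Multiset.map_map] at hP
      obtain ⟨b, hb, rfl⟩ := Multiset.mem_map.mp hP
      simp [residue_eq_zero_of_mem_outInvRoots A hb]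
    rw [h1, mul_one]
    rfl

end Model

/-! ## Gauss values and the dominant index -/

section Gauss

/-- The Gauss value of `f`: the maximum of the valuations of its coefficients (`0` for `f = 0`).
[folklore] -/
def gaussVal (f : K[X]) : A.ValueGroup :=
  if h : f.support.Nonempty then f.support.sup' h fun i => A.valuation (f.coeff i) else 0

/-- The Gauss value of `0` is `0`. [folklore] -/
theorem gaussVal_zero : gaussVal A (0 : K[X]) = 0 := by
  simp [gaussVal]

/-- Every coefficient is bounded by the Gauss value. [folklore] -/
theorem valuation_coeff_le_gaussVal (f : K[X]) (i : ℕ) : A.valuation (f.coeff i) ≤ gaussVal A f := by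
  by_cases hi : i ∈ f.support
  · have h : f.support.Nonempty := ⟨i, hi⟩
    rw [gaussVal, dif_pos h]
    exact Finset.le_sup' (fun i => A.valuation (f.coeff i)) hi
  · rw [notMem_support_iff.mp hi, map_zero]
    exact zero_le

/-- The Gauss value of a non-zero polynomial is attained at some coefficient. [folklore] -/
theorem exists_valuation_coeff_eq_gaussVal {f : K[X]} (hf : f ≠ 0) :
    ∃ i, A.valuation (f.coeff i) = gaussVal A f := by
  have h : f.support.Nonempty := support_nonempty.mpr hf
  rw [gaussVal, dif_pos h]
  obtain ⟨i, -, hi⟩ := Finset.exists_mem_eq_sup' h fun i => A.valuation (f.coeff i)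
  exact ⟨i, hi.symm⟩

/-- A bound on all coefficients bounds the Gauss value. [folklore] -/
theorem gaussVal_le {f : K[X]} {γ : A.ValueGroup} (h : ∀ i, A.valuation (f.coeff i) ≤ γ) :
    gaussVal A f ≤ γ := by
  by_cases hf : f = 0
  · rw [hf, gaussVal_zero]; exact zero_le
  · obtain ⟨i, hi⟩ := exists_valuation_coeff_eq_gaussVal A hf
    rw [← hi]; exact h i

/-- The Gauss value is positive for `f ≠ 0`. [folklore] -/
theorem gaussVal_ne_zero {f : K[X]} (hf : f ≠ 0) : gaussVal A f ≠ 0 := by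
  obtain ⟨i, hi⟩ : ∃ i, f.coeff i ≠ 0 := by
    by_contra h
    push Not at h
    exact hf (Polynomial.ext fun i => by rw [h i, coeff_zero])
  intro h0
  have := valuation_coeff_le_gaussVal A f i
  rw [h0, le_zero_iff, Valuation.zero_iff] at this
  exact hi this

/-- Gauss value of a constant multiple. [folklore] -/
theorem gaussVal_C_mul (c : K) (f : K[X]) : gaussVal A (C c * f) = A.valuation c * gaussVal A f := by
  by_cases hc : c = 0
  · simp [hc, gaussVal_zero]
  by_cases hf : f = 0
  · simp [hf, gaussVal_zero]
  apply le_antisymm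
  · exact gaussVal_le A fun i => by
      rw [coeff_C_mul, map_mul]
      exact mul_le_mul_right (valuation_coeff_le_gaussVal A f i) _
  · obtain ⟨i, hi⟩ := exists_valuation_coeff_eq_gaussVal A hf
    calc A.valuation c * gaussVal A f = A.valuation ((C c * f).coeff i) := by
          rw [coeff_C_mul, map_mul, hi]
      _ ≤ gaussVal A (C c * f) := valuation_coeff_le_gaussVal A _ i

/-- A polynomial with coefficients in `A` has Gauss value `≤ 1`. [folklore] -/
theorem gaussVal_map_le_one (g : A[X]) : gaussVal A (g.map (algebraMap A K)) ≤ 1 :=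
  gaussVal_le A fun i => by
    rw [coeff_map]
    exact A.valuation_le_one _

/-- A polynomial over `A` with non-zero reduction has Gauss value exactly `1`. [folklore] -/
theorem gaussVal_map_eq_one {g : A[X]} (hg : g.map (residue A) ≠ 0) :
    gaussVal A (g.map (algebraMap A K)) = 1 := by
  refine le_antisymm (gaussVal_map_le_one A g) ?_
  obtain ⟨i, hi⟩ : ∃ i, (g.map (residue A)).coeff i ≠ 0 := by
    by_contra h
    push Not at h
    exact hg (Polynomial.ext fun i => by rw [h i, coeff_zero])
  rw [coeff_map, residue_ne_zero_iff_isUnit, A.valuation_eq_one_iff] at hi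
  calc (1 : A.ValueGroup) = A.valuation ((g.map (algebraMap A K)).coeff i) := by
        rw [coeff_map, ValuationSubring.algebraMap_apply, hi]
    _ ≤ _ := valuation_coeff_le_gaussVal A _ i

variable {A}

/-- For a primitive model `g = c f` of `f`: `v(c) · gaussVal f = 1`. [folklore] -/
theorem valuation_mul_gaussVal_eq_one [Nontrivial (ResidueField A)] {f : K[X]} {c : K} {g : A[X]}
    (hgf : g.map (algebraMap A K) = C c * f) (hgr : g.map (residue A) = redPoly A f) :
    A.valuation c * gaussVal A f = 1 := by
  rw [← gaussVal_C_mul, ← hgf]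
  exact gaussVal_map_eq_one A (by rw [hgr]; exact redPoly_ne_zero A f)

variable (A)

/-- **The dominant index.**  If `f ≠ 0` splits, the coefficient of `f` in degree
`n = #intRoots A f` (the number of roots of valuation `≤ 1`) has valuation equal to the Gauss value.
[folklore] -/
theorem valuation_coeff_card_intRoots [Nontrivial (ResidueField A)] {f : K[X]} (hf : f ≠ 0)
    (hs : f.Splits) :
    A.valuation (f.coeff (Multiset.card (intRoots A f))) = gaussVal A f := by
  obtain ⟨c, hc, g, hgf, hgr⟩ := exists_model A hf hs
  have hvc : A.valuation c ≠ 0 := (Valuation.ne_zero_iff _).mpr hc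
  have h1 := valuation_mul_gaussVal_eq_one hgf hgr
  -- the coefficient of the model in degree `n` is a unit
  have hdeg : (redPoly A f).natDegree = Multiset.card (intRoots A f) := natDegree_redPoly A f
  set n := Multiset.card (intRoots A f) with hn
  have hcoeff : residue A (g.coeff n) = 1 := by
    have := congrArg (fun P => P.coeff n) hgr
    simp only [coeff_map] at this
    rw [this, ← hdeg]
    exact (monic_redPoly A f).coeff_natDegree
  have hunit : A.valuation ((g.coeff n : A) : K) = 1 := by
    rw [← A.valuation_eq_one_iff, ← residue_ne_zero_iff_isUnit, hcoeff]
    exact one_ne_zero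
  have hgn : A.valuation ((C c * f).coeff n) = 1 := by
    rw [← hgf, coeff_map, ValuationSubring.algebraMap_apply, hunit]
  rw [coeff_C_mul, map_mul] at hgn
  -- compare with `v c * gaussVal f = 1`
  have : A.valuation c * A.valuation (f.coeff n) = A.valuation c * gaussVal A f := by rw [hgn, h1]
  exact mul_left_cancel₀ hvc this

/-- **The dominant index is the last one.**  If `f ≠ 0` splits, every coefficient of `f` in degree
`> #intRoots A f` has valuation strictly below the Gauss value. [folklore] -/
theorem valuation_coeff_lt_gaussVal [Nontrivial (ResidueField A)] {f : K[X]} (hf : f ≠ 0)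
    (hs : f.Splits) {i : ℕ} (hi : Multiset.card (intRoots A f) < i) :
    A.valuation (f.coeff i) < gaussVal A f := by
  obtain ⟨c, hc, g, hgf, hgr⟩ := exists_model A hf hs
  have hvc : A.valuation c ≠ 0 := (Valuation.ne_zero_iff _).mpr hc
  have h1 := valuation_mul_gaussVal_eq_one hgf hgr
  have hcoeff : residue A (g.coeff i) = 0 := by
    have := congrArg (fun P => P.coeff i) hgr
    simp only [coeff_map] at this
    rw [this]
    apply coeff_eq_zero_of_natDegree_lt
    rwa [natDegree_redPoly]
  have hlt : A.valuation ((g.coeff i : A) : K) < 1 := by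
    rw [← A.valuation_lt_one_iff, ← residue_eq_zero_iff]; exact hcoeff
  have hgi : A.valuation ((C c * f).coeff i) < 1 := by
    rw [← hgf, coeff_map, ValuationSubring.algebraMap_apply]; exact hlt
  rw [coeff_C_mul, map_mul, ← h1] at hgi
  exact lt_of_mul_lt_mul_left' hgi

/-- In particular the number of integral roots of a split `f ≠ 0` is at most its degree and the
Gauss value is the valuation of an actual coefficient; restated: `#intRoots A f ≤ natDegree f`.
[folklore] -/
theorem card_intRoots_le_natDegree (f : K[X]) :
    Multiset.card (intRoots A f) ≤ f.natDegree := by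
  rw [card_intRoots]
  exact (Multiset.card_le_card (Multiset.filter_le _ _)).trans (card_roots' f)

end Gauss

/-! ## Taylor coefficients at an integral centre -/

section Taylor

/-- Reduction commutes with Taylor expansion at an integral centre. [folklore] -/
theorem map_taylor_residue (g : A[X]) (a : A) :
    (taylor a g).map (residue A) = taylor (residue A a) (g.map (residue A)) := by
  rw [taylor_apply, taylor_apply, Polynomial.map_comp, Polynomial.map_add, map_X, map_C]

/-- Over a domain, the Taylor expansion of `h` at `a` starts in degree `rootMultiplicity a h`:
lower coefficients vanish. [folklore] -/
theorem taylor_coeff_eq_zero_of_lt_rootMultiplicity {R : Type*} [CommRing R] [IsDomain R]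
    (h : R[X]) (a : R) {i : ℕ} (hi : i < h.rootMultiplicity a) : (taylor a h).coeff i = 0 := by
  have hdvd : (X - C a) ^ h.rootMultiplicity a ∣ h := pow_rootMultiplicity_dvd h a
  obtain ⟨u, hu⟩ := hdvd
  have : taylor a h = X ^ h.rootMultiplicity a * taylor a u := by
    conv_lhs => rw [hu]
    rw [taylor_mul, taylor_pow, map_sub (taylor a), taylor_X, taylor_C, add_sub_cancel_right]
  rw [this, coeff_X_pow_mul', if_neg (not_le.mpr hi)]

/-- Over a domain, for `h ≠ 0` the Taylor coefficient of `h` at `a` in degree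
`rootMultiplicity a h` is non-zero. [folklore] -/
theorem taylor_coeff_rootMultiplicity_ne_zero {R : Type*} [CommRing R] [IsDomain R] {h : R[X]}
    (hh : h ≠ 0) (a : R) : (taylor a h).coeff (h.rootMultiplicity a) ≠ 0 := by
  set k := h.rootMultiplicity a with hk
  have hu := (pow_mul_divByMonic_rootMultiplicity_eq h a)
  set u := h /ₘ (X - C a) ^ k with hu_def
  have hu0 : u.eval a ≠ 0 := by
    rw [hu_def, hk]; exact eval_divByMonic_pow_rootMultiplicity_ne_zero a hh
  have : taylor a h = X ^ k * taylor a u := by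
    conv_lhs => rw [← hu]
    rw [taylor_mul, taylor_pow, map_sub (taylor a), taylor_X, taylor_C, add_sub_cancel_right]
  rw [this, coeff_X_pow_mul', if_pos le_rfl, Nat.sub_self, taylor_coeff_zero]
  exact hu0

variable {A}

/-- **Taylor coefficients of a primitive model.**  Let `g ∈ A[X]` have non-zero reduction `ḡ` and
let `a ∈ A`, `k = ord_{ā} ḡ`.  Then the Taylor coefficients of `g` at `a` in degrees `< k` reduce to
`0` … [folklore] -/
theorem residue_taylor_coeff_eq_zero {g : A[X]} (a : A) {i : ℕ}
    (hi : i < (g.map (residue A)).rootMultiplicity (residue A a)) :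
    residue A ((taylor a g).coeff i) = 0 := by
  have h := taylor_coeff_eq_zero_of_lt_rootMultiplicity (g.map (residue A)) (residue A a) hi
  rwa [← map_taylor_residue, coeff_map] at h

/-- … and the one in degree `k` is a unit (valuation `1`); no factorials are involved.
[folklore] -/
theorem isUnit_taylor_coeff {g : A[X]} (hg : g.map (residue A) ≠ 0) (a : A) :
    IsUnit ((taylor a g).coeff ((g.map (residue A)).rootMultiplicity (residue A a))) := by
  rw [← residue_ne_zero_iff_isUnit]
  have h := taylor_coeff_rootMultiplicity_ne_zero hg (residue A a)
  rwa [← map_taylor_residue, coeff_map] at h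

end Taylor


/-! ## The first index of full valuation -/

section First

/-- The number of integral roots of `f` reducing to `0` is the number of roots of valuation `< 1`.
[folklore] -/
theorem count_redRoots_zero (f : K[X]) :
    (redRoots A f).count 0 = Multiset.card (f.roots.filter fun α => A.valuation α < 1) := by
  rw [count_redRoots, ← Multiset.card_map Subtype.val]
  have hmap : ((intRoots A f).filter fun b => residue A b = 0).map Subtype.val =
      ((intRoots A f).map Subtype.val).filter fun α => A.valuation α < 1 := by
    rw [Multiset.filter_map]
    congr 1
    refine Multiset.filter_congr fun b _ => ?_
    simp only [Function.comp_apply]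
    rw [residue_eq_zero_iff, A.valuation_lt_one_iff]
  rw [hmap, map_val_intRoots, Multiset.filter_filter]
  congr 1
  refine Multiset.filter_congr fun α _ => ?_
  constructor
  · rintro ⟨h, -⟩; exact h
  · intro h; exact ⟨h, (A.valuation_le_one_iff α).mp h.le⟩

/-- **The first index of full valuation.**  If `f ≠ 0` splits, the coefficient in degree
`k = #{roots of valuation < 1}` (`= ord₀ (redPoly A f)`) has valuation equal to the Gauss value …
[folklore] -/
theorem valuation_coeff_count_redRoots_zero [Nontrivial (ResidueField A)] {f : K[X]} (hf : f ≠ 0)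
    (hs : f.Splits) :
    A.valuation (f.coeff ((redRoots A f).count 0)) = gaussVal A f := by
  obtain ⟨c, hc, g, hgf, hgr⟩ := exists_model A hf hs
  have hvc : A.valuation c ≠ 0 := (Valuation.ne_zero_iff _).mpr hc
  have h1 := valuation_mul_gaussVal_eq_one hgf hgr
  have hg0 : g.map (residue A) ≠ 0 := by rw [hgr]; exact redPoly_ne_zero A f
  have hk : (g.map (residue A)).rootMultiplicity (residue A 0) = (redRoots A f).count 0 := by
    rw [map_zero, hgr, rootMultiplicity_redPoly]
  have hunit := isUnit_taylor_coeff hg0 0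
  rw [hk, taylor_zero] at hunit
  rw [A.valuation_eq_one_iff] at hunit
  have hgn : A.valuation ((C c * f).coeff ((redRoots A f).count 0)) = 1 := by
    rw [← hgf, coeff_map, ValuationSubring.algebraMap_apply, hunit]
  rw [coeff_C_mul, map_mul] at hgn
  have : A.valuation c * A.valuation (f.coeff ((redRoots A f).count 0)) =
      A.valuation c * gaussVal A f := by rw [hgn, h1]
  exact mul_left_cancel₀ hvc this

/-- … and every coefficient of lower degree has valuation strictly below the Gauss value.
[folklore] -/
theorem valuation_coeff_lt_gaussVal_of_lt [Nontrivial (ResidueField A)] {f : K[X]} (hf : f ≠ 0)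
    (hs : f.Splits) {i : ℕ} (hi : i < (redRoots A f).count 0) :
    A.valuation (f.coeff i) < gaussVal A f := by
  obtain ⟨c, hc, g, hgf, hgr⟩ := exists_model A hf hs
  have h1 := valuation_mul_gaussVal_eq_one hgf hgr
  have hk : (g.map (residue A)).rootMultiplicity (residue A 0) = (redRoots A f).count 0 := by
    rw [map_zero, hgr, rootMultiplicity_redPoly]
  have hzero := residue_taylor_coeff_eq_zero (g := g) 0 (hk ▸ hi)
  rw [taylor_zero] at hzero
  rw [residue_eq_zero_iff, A.valuation_lt_one_iff] at hzero
  have hgi : A.valuation ((C c * f).coeff i) < 1 := by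
    rw [← hgf, coeff_map, ValuationSubring.algebraMap_apply]; exact hzero
  rw [coeff_C_mul, map_mul, ← h1] at hgi
  exact lt_of_mul_lt_mul_left' hgi

end First

/-! ## Rescaling to a disc -/

section Rescale

variable {A}

/-- The roots of `f(s + c X)` are the `(α - s)/c` for the roots `α` of `f` (`c ≠ 0`). [folklore] -/
theorem roots_comp_C_add_C_mul_X (f : K[X]) (s : K) {c : K} (hc : c ≠ 0) :
    (f.comp (C s + C c * X)).roots = f.roots.map fun α => c⁻¹ * (α - s) := by
  have h := roots_comp_C_mul_X_add_C f c s (Ne.isUnit hc)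
  rw [add_comm (C s)]
  rw [h]
  congr 1
  funext α
  rw [Ring.inverse_eq_inv']

/-- The number of roots of `f` (with multiplicity) in the closed disc `{x : v(x - s) ≤ v(c)}`
is the number of integral roots of the rescaled polynomial `f(s + c X)`. [folklore] -/
theorem card_intRoots_comp (f : K[X]) (s : K) {c : K} (hc : c ≠ 0) :
    Multiset.card (intRoots A (f.comp (C s + C c * X))) =
      Multiset.card (f.roots.filter fun α => A.valuation (α - s) ≤ A.valuation c) := by
  rw [card_intRoots, roots_comp_C_add_C_mul_X f s hc, Multiset.filter_map, Multiset.card_map]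
  congr 1
  refine Multiset.filter_congr fun α _ => ?_
  simp only [Function.comp_apply]
  rw [← A.valuation_le_one_iff, map_mul, map_inv₀]
  have hvc : A.valuation c ≠ 0 := (Valuation.ne_zero_iff _).mpr hc
  rw [inv_mul_le_iff₀ (zero_lt_iff.mpr hvc), mul_one]

/-- The coefficients of `f(s + c X)` are the Taylor coefficients of `f` at `s` scaled by powers of
`c`. [folklore] -/
theorem coeff_comp_C_add_C_mul_X (f : K[X]) (s c : K) (i : ℕ) :
    (f.comp (C s + C c * X)).coeff i = (taylor s f).coeff i * c ^ i := by
  have : f.comp (C s + C c * X) = (taylor s f).comp (C c * X) := by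
    rw [taylor_apply, comp_assoc, add_comp, X_comp, C_comp, add_comm]
  rw [this, comp_C_mul_X_coeff, mul_comm]

/-- Rescaling a non-zero polynomial by a non-zero factor gives a non-zero polynomial. [folklore] -/
theorem comp_C_add_C_mul_X_ne_zero {f : K[X]} (hf : f ≠ 0) (s : K) {c : K} (hc : c ≠ 0) :
    f.comp (C s + C c * X) ≠ 0 := by
  intro h
  have hdeg : (f.comp (C s + C c * X)).natDegree = f.natDegree := by
    have h1 : (C s + C c * X).natDegree = 1 := by
      rw [add_comm, natDegree_add_C, natDegree_C_mul_X c hc]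
    rw [natDegree_comp, h1, mul_one]
  rw [h, natDegree_zero] at hdeg
  have hf0 : f.natDegree = 0 := hdeg.symm
  obtain ⟨a, rfl⟩ := natDegree_eq_zero.mp hf0
  rw [C_comp] at h
  exact hf h

/-- Rescaling preserves splitting. [folklore] -/
theorem splits_comp_C_add_C_mul_X {f : K[X]} (hs : f.Splits) (s c : K) :
    (f.comp (C s + C c * X)).Splits := by
  refine hs.comp_of_natDegree_le_one ?_
  calc (C s + C c * X).natDegree ≤ max (C s).natDegree (C c * X).natDegree := natDegree_add_le _ _
    _ ≤ 1 := max_le (by rw [natDegree_C]; exact zero_le_one)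
        ((natDegree_C_mul_le c X).trans natDegree_X_le)

variable (A)

/-- The number of roots of `f` (with multiplicity) in the closed disc `D(s, γ) = {v(x - s) ≤ γ}`.
[folklore] -/
def rootsIn (f : K[X]) (s : K) (γ : A.ValueGroup) : ℕ :=
  Multiset.card (f.roots.filter fun α => A.valuation (α - s) ≤ γ)

/-- The number of roots of `f` (with multiplicity) in the open disc `D⁻(s, γ) = {v(x - s) < γ}`.
[folklore] -/
def rootsInOpen (f : K[X]) (s : K) (γ : A.ValueGroup) : ℕ :=
  Multiset.card (f.roots.filter fun α => A.valuation (α - s) < γ)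

/-- The Gauss value of `f` on the disc `D(s, γ)`: `max_i v(F_i) γ^i` for the Taylor coefficients
`F_i` of `f` at `s`. [folklore] -/
def gaussValAt (f : K[X]) (s : K) (γ : A.ValueGroup) : A.ValueGroup :=
  if h : (taylor s f).support.Nonempty then
    (taylor s f).support.sup' h fun i => A.valuation ((taylor s f).coeff i) * γ ^ i
  else 0

variable {A}

/-- `rootsIn` is the number of integral roots of the rescaled polynomial. [folklore] -/
theorem card_intRoots_comp_eq_rootsIn (f : K[X]) (s : K) {c : K} (hc : c ≠ 0) :
    Multiset.card (intRoots A (f.comp (C s + C c * X))) = rootsIn A f s (A.valuation c) :=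
  card_intRoots_comp f s hc

/-- `rootsInOpen` is the number of integral roots of the rescaled polynomial with residue `0`.
[folklore] -/
theorem count_redRoots_comp_zero (f : K[X]) (s : K) {c : K} (hc : c ≠ 0) :
    (redRoots A (f.comp (C s + C c * X))).count 0 = rootsInOpen A f s (A.valuation c) := by
  rw [count_redRoots_zero, roots_comp_C_add_C_mul_X f s hc, Multiset.filter_map, Multiset.card_map,
    rootsInOpen]
  congr 1
  refine Multiset.filter_congr fun α _ => ?_
  simp only [Function.comp_apply]
  have hvc : A.valuation c ≠ 0 := (Valuation.ne_zero_iff _).mpr hc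
  rw [map_mul, map_inv₀, inv_mul_lt_iff₀ (zero_lt_iff.mpr hvc), mul_one]

/-- Each term `v(F_i) γ^i` is bounded by the Gauss value on `D(s, γ)`. [folklore] -/
theorem valuation_taylor_coeff_mul_le_gaussValAt (f : K[X]) (s : K) (γ : A.ValueGroup) (i : ℕ) :
    A.valuation ((taylor s f).coeff i) * γ ^ i ≤ gaussValAt A f s γ := by
  by_cases hi : i ∈ (taylor s f).support
  · have h : (taylor s f).support.Nonempty := ⟨i, hi⟩
    rw [gaussValAt, dif_pos h]
    exact Finset.le_sup' (fun i => A.valuation ((taylor s f).coeff i) * γ ^ i) hi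
  · rw [notMem_support_iff.mp hi, map_zero, zero_mul]
    exact zero_le

/-- The Gauss value on `D(s, γ)` is attained at some Taylor coefficient (for `f ≠ 0`). [folklore] -/
theorem exists_eq_gaussValAt {f : K[X]} (hf : f ≠ 0) (s : K) (γ : A.ValueGroup) :
    ∃ i, A.valuation ((taylor s f).coeff i) * γ ^ i = gaussValAt A f s γ := by
  have h0 : taylor s f ≠ 0 := fun h => hf (taylor_injective s (by rw [h, map_zero]))
  have h : (taylor s f).support.Nonempty := support_nonempty.mpr h0
  rw [gaussValAt, dif_pos h]
  obtain ⟨i, -, hi⟩ :=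
    Finset.exists_mem_eq_sup' h fun i => A.valuation ((taylor s f).coeff i) * γ ^ i
  exact ⟨i, hi.symm⟩

/-- **Rescaling computes the Gauss value on a disc**: `gaussVal (f(s + cX)) = gaussValAt f s (v c)`.
[folklore] -/
theorem gaussVal_comp (f : K[X]) (s c : K) :
    gaussVal A (f.comp (C s + C c * X)) = gaussValAt A f s (A.valuation c) := by
  apply le_antisymm
  · refine gaussVal_le A fun i => ?_
    rw [coeff_comp_C_add_C_mul_X, map_mul, map_pow]
    exact valuation_taylor_coeff_mul_le_gaussValAt f s _ i
  · by_cases hf : f = 0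
    · simp [hf, gaussValAt, gaussVal_zero]
    obtain ⟨i, hi⟩ := exists_eq_gaussValAt hf s (A.valuation c)
    rw [← hi, ← map_pow, ← map_mul, ← coeff_comp_C_add_C_mul_X]
    exact valuation_coeff_le_gaussVal A _ i

/-- **Dominant index on a disc.**  For `f ≠ 0` split and `c ≠ 0`, `γ = v(c)`, `n = rootsIn f s γ`:
`v(F_n) γ^n` equals the Gauss value on `D(s, γ)` … [folklore] -/
theorem valuation_taylor_coeff_rootsIn [Nontrivial (ResidueField A)] {f : K[X]} (hf : f ≠ 0)
    (hs : f.Splits) (s : K) {c : K} (hc : c ≠ 0) :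
    A.valuation ((taylor s f).coeff (rootsIn A f s (A.valuation c))) * A.valuation c ^
        rootsIn A f s (A.valuation c) = gaussValAt A f s (A.valuation c) := by
  have h := valuation_coeff_card_intRoots A (comp_C_add_C_mul_X_ne_zero hf s hc)
    (splits_comp_C_add_C_mul_X hs s c)
  rwa [card_intRoots_comp_eq_rootsIn f s hc, coeff_comp_C_add_C_mul_X, map_mul, map_pow,
    gaussVal_comp] at h

/-- … the terms of index `> n` are strictly smaller … [folklore] -/
theorem valuation_taylor_coeff_lt_of_rootsIn_lt [Nontrivial (ResidueField A)] {f : K[X]}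
    (hf : f ≠ 0) (hs : f.Splits) (s : K) {c : K} (hc : c ≠ 0) {i : ℕ}
    (hi : rootsIn A f s (A.valuation c) < i) :
    A.valuation ((taylor s f).coeff i) * A.valuation c ^ i < gaussValAt A f s (A.valuation c) := by
  have h := valuation_coeff_lt_gaussVal A (comp_C_add_C_mul_X_ne_zero hf s hc)
    (splits_comp_C_add_C_mul_X hs s c) (i := i) (by rwa [card_intRoots_comp_eq_rootsIn f s hc])
  rwa [coeff_comp_C_add_C_mul_X, map_mul, map_pow, gaussVal_comp] at h

/-- … the term of index `k = rootsInOpen f s γ` (roots in the OPEN disc) also attains the Gauss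
value … [folklore] -/
theorem valuation_taylor_coeff_rootsInOpen [Nontrivial (ResidueField A)] {f : K[X]} (hf : f ≠ 0)
    (hs : f.Splits) (s : K) {c : K} (hc : c ≠ 0) :
    A.valuation ((taylor s f).coeff (rootsInOpen A f s (A.valuation c))) * A.valuation c ^
        rootsInOpen A f s (A.valuation c) = gaussValAt A f s (A.valuation c) := by
  have h := valuation_coeff_count_redRoots_zero A (comp_C_add_C_mul_X_ne_zero hf s hc)
    (splits_comp_C_add_C_mul_X hs s c)
  rwa [count_redRoots_comp_zero f s hc, coeff_comp_C_add_C_mul_X, map_mul, map_pow,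
    gaussVal_comp] at h

/-- … and the terms of index `< k` are strictly smaller. [folklore] -/
theorem valuation_taylor_coeff_lt_of_lt_rootsInOpen [Nontrivial (ResidueField A)] {f : K[X]}
    (hf : f ≠ 0) (hs : f.Splits) (s : K) {c : K} (hc : c ≠ 0) {i : ℕ}
    (hi : i < rootsInOpen A f s (A.valuation c)) :
    A.valuation ((taylor s f).coeff i) * A.valuation c ^ i < gaussValAt A f s (A.valuation c) := by
  have h := valuation_coeff_lt_gaussVal_of_lt A (comp_C_add_C_mul_X_ne_zero hf s hc)
    (splits_comp_C_add_C_mul_X hs s c) (i := i) (by rwa [count_redRoots_comp_zero f s hc])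
  rwa [coeff_comp_C_add_C_mul_X, map_mul, map_pow, gaussVal_comp] at h

/-- `rootsInOpen ≤ rootsIn`. [folklore] -/
theorem rootsInOpen_le_rootsIn (f : K[X]) (s : K) (γ : A.ValueGroup) :
    rootsInOpen A f s γ ≤ rootsIn A f s γ :=
  Multiset.card_le_card (Multiset.monotone_filter_right _ fun _ h => h.le)

/-- `rootsIn` is monotone in the radius. [folklore] -/
theorem rootsIn_mono (f : K[X]) (s : K) {γ γ' : A.ValueGroup} (h : γ ≤ γ') :
    rootsIn A f s γ ≤ rootsIn A f s γ' :=
  Multiset.card_le_card (Multiset.monotone_filter_right _ fun _ h' => h'.trans h)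

/-- If no root `α` of `f` has `γ < v(α - s) ≤ γ'`, the closed discs `D(s, γ) ⊆ D(s, γ')` contain the
same roots. [folklore] -/
theorem rootsIn_eq_of_forall_not_mem {f : K[X]} {s : K} {γ γ' : A.ValueGroup} (hle : γ ≤ γ')
    (h : ∀ α ∈ f.roots, ¬ (γ < A.valuation (α - s) ∧ A.valuation (α - s) ≤ γ')) :
    rootsIn A f s γ' = rootsIn A f s γ := by
  unfold rootsIn
  congr 1
  refine Multiset.filter_congr fun α hα => ⟨fun h' => ?_, fun h' => h'.trans hle⟩
  by_contra hlt
  exact h α hα ⟨not_le.mp hlt, h'⟩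

/-- If no root `α` of `f` has `γ ≤ v(α - s) < γ'`, then the open disc `D⁻(s, γ')` and the closed
disc `D(s, γ)`… more precisely `rootsInOpen f s γ' = rootsInOpen f s γ`; together with the previous
lemma this pins the root counts on an annulus free of roots. [folklore] -/
theorem rootsInOpen_eq_rootsIn_of_forall_not_mem {f : K[X]} {s : K} {γ γ' : A.ValueGroup}
    (hlt : γ < γ')
    (h : ∀ α ∈ f.roots, ¬ (γ < A.valuation (α - s) ∧ A.valuation (α - s) < γ')) :
    rootsInOpen A f s γ' = rootsIn A f s γ := by
  unfold rootsIn rootsInOpen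
  congr 1
  refine Multiset.filter_congr fun α hα => ⟨fun h' => ?_, fun h' => lt_of_le_of_lt h' hlt⟩
  by_contra hle
  exact h α hα ⟨not_le.mp hle, h'⟩

end Rescale

end Literature.RingTheory.Valuation
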